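import Mathlib
import Summits.NavierStokesRegularity.NavierStokesRegularity.Theorems.EulerZoomLiouvillePowerGaugeEulerLiouvilleRadialPressureForm
import Summits.NavierStokesRegularity.NavierStokesRegularity.Theorems.EulerZoomLiouvillePowerGaugeEulerLiouvilleDriftClockMember
import HarnessLib

/-!
# «ABSOLUTE RADIAL-PRESSURE FORM» (h-free) of the absolute inflow-band deficit kill
# (crux `EulerZoomLiouville.PowerGaugeEulerLiouville` = stmt-NavierStokesRegularity-19832, THE ONE STATEMENT `stub_selfSimilarC2Needle`;
# binder `HasFastVorticalChannel` — LEAD ns-typeII-p2 g13 KEY K-sfl 2026-08-28T22:34:18Z «twin of p673283 over MY alternative 4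
# (absolute band, `…DriftClockMember` p674010)»; width seat ns-sfl-p1 g6)

Route `EulerZoomLiouville` (NavierStokesRegularity), crux E.  With `W y = γy + V y` (`selfSimilarTransport γ 0 V`), `ℛ(y) = ⟪y, W y⟫`,
`γ = 1/(2+ρ)`, and the forward RADIAL ACCELERATION `a(y) = ‖W y‖² + γ⟪y, W y⟫ + ⟪y, DV(y)(W y)⟫`:
* (R1″) **`RadialPressureForm.absDeficit_of_radialPressureDeficit`** — CLASS-FREE pointwise: for a classical profile with `γ ≤ ½`, at a point
  with `⟪y, W y⟫ ≤ 0` and the ABSOLUTE radial-pressure deficit `⟪y, ∇P′(y)⟫ ≤ ‖W y‖² + γ(1−γ)‖y‖² − a₀`, one has `a(y) ≥ a₀`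
  (ns-ezl-w1 g6's `VirialForm.radialAcceleration_eq`: `a = ‖W‖² + γ(1−γ)‖y‖² − (1−2γ)ℛ − ⟪y, ∇P′⟫`, and `−(1−2γ)ℛ ≥ 0` on the band).
* (R2″) **`Loc.selfSimilar_ae_eq_zero_of_absRadialPressureDeficitC2_profile`** — MEMBER LEVEL (crux hypotheses verbatim, `0 < ρ ≤ ½`, exact
  self-similarity about the origin, `V ∈ C²`): if for ONE pair `κb, a₀ > 0`, every classical pressure `P′` and every level `h` there is a
  radius beyond which every VORTICAL `ℋ_{P′}`-high point of the ABSOLUTE INFLOW BAND `−κb ≤ ⟪y, W y⟫ ≤ 0` has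
  `⟪y, ∇P′(y)⟫ ≤ ‖W y‖² + γ(1−γ)‖y‖² − a₀`, the member is trivial — a by-name corollary of the LEAD's
  `Loc.selfSimilar_ae_eq_zero_of_absBandDeficitC2_profile` (`…DriftClockMember`, alternative 4 «any inward drift kills»).
* **`Past.selfSimilar_ae_eq_zero_of_absRadialPressureDeficitC2_profile_past`** — the same for members exactly self-similar about `(T, x₀)`
  for `τ < T₁` only (`…_absBandDeficitC2_profile_past`).
Reading for THE ONE STATEMENT (its negation): for all `κb, a₀ > 0` the needle has, beyond every radius, vortical Bernoulli-high points of the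
absolute inflow band whose radial pressure gradient exceeds «centrifugal − a₀»: `⟪y, ∇P′⟫ > ‖W y‖² + γ(1−γ)‖y‖² − a₀`.
WHAT THIS IS NOT: not NS, not E — a pointwise inequality and by-name corollaries on the model lattice, `--supports` stmt-19832; DENT 0 on the
registered stubs; 19832 OPEN; NS regularity is NOT proved; no summit statement is proved by this seat.
[folklore; cf. ConstantinIgnatovaVicol2026Putative §3.1.1 (3.3), §3.4 (3.19), §3.4.3 (3.30)]
-/

noncomputable section

-- flat `Theorems/<Route><Decl>…` files of one crux share the namespace of the crux (tree convention: `Summit.<S>.<S>.…`)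
set_option linter.dupNamespace false

open Set Filter Topology Metric Function MeasureTheory
open scoped RealInnerProductSpace NNReal ENNReal

namespace Summit.NavierStokesRegularity.NavierStokesRegularity.Theorems.PowerGaugeEulerLiouville

open Literature.Analysis Literature.Analysis.FluidPDE

namespace RadialPressureForm

variable {γ : ℝ} {V : EuclideanSpace ℝ (Fin 3) → EuclideanSpace ℝ (Fin 3)} {P : EuclideanSpace ℝ (Fin 3) → ℝ}

/-- **(R1″) FROM AN ABSOLUTE RADIAL-PRESSURE DEFICIT TO THE ABSOLUTE BAND DEFICIT** (class-free, pointwise, h-free): for a classical profile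
with `γ ≤ ½`, at a point with `⟪y, W y⟫ ≤ 0` and `⟪y, ∇P(y)⟫ ≤ ‖W y‖² + γ(1−γ)‖y‖² − a₀`, the radial acceleration satisfies `a(y) ≥ a₀`.
[folklore] -/
theorem absDeficit_of_radialPressureDeficit (hprof : IsSelfSimilarEulerProfile γ 0 V P) (hγ : γ ≤ 1 / 2) {a₀ : ℝ}
    {y : EuclideanSpace ℝ (Fin 3)} (hR : ⟪y, selfSimilarTransport γ 0 V y⟫ ≤ 0)
    (hgrad : ⟪y, gradient P y⟫ ≤ ‖selfSimilarTransport γ 0 V y‖ ^ 2 + γ * (1 - γ) * ‖y‖ ^ 2 - a₀) :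
    a₀ ≤ ‖selfSimilarTransport γ 0 V y‖ ^ 2 + γ * ⟪y, selfSimilarTransport γ 0 V y⟫ +
      ⟪y, fderiv ℝ V y (selfSimilarTransport γ 0 V y)⟫ := by
  rw [VirialForm.radialAcceleration_eq hprof y, WeakBernoulli.bernoulli_zero_apply]
  rw [WeakBernoulli.norm_transport_zero_sq] at hgrad
  have h1 : 0 ≤ -((1 - 2 * γ) * ⟪y, selfSimilarTransport γ 0 V y⟫) := by
    rw [neg_mul_eq_neg_mul]
    exact mul_nonneg_of_nonpos_of_nonpos (by linarith) hR
  linarith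

end RadialPressureForm

/-- **(R2″) EXACTLY SELF-SIMILAR MEMBERS WHOSE `C²` PROFILE HAS AN ABSOLUTE RADIAL-PRESSURE DEFICIT ON THE FAR VORTICAL BERNOULLI-HIGH ABSOLUTE
INFLOW BAND ARE TRIVIAL.**  Crux hypotheses verbatim (`0 < ρ ≤ ½`, `γ = 1/(2+ρ)`), exact self-similarity about the origin, `V ∈ C²`; for ONE pair
`κb > 0`, `a₀ > 0`, every classical pressure `P′` of the profile and every level `h` there is `R₀` such that every point `y` with `‖y‖ ≥ R₀`,
`ℋ_{P′}(y) > h`, `curl V y ≠ 0`, `−κb ≤ ⟪y, W y⟫ ≤ 0` has `⟪y, ∇P′(y)⟫ ≤ ‖W y‖² + γ(1−γ)‖y‖² − a₀`.  Then `u = 0` a.e. on the slab.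
Proof: `RadialPressureForm.absDeficit_of_radialPressureDeficit` turns the hypothesis into the absolute band deficit of the LEAD's
`Loc.selfSimilar_ae_eq_zero_of_absBandDeficitC2_profile`. [folklore; cf. ConstantinIgnatovaVicol2026Putative §3.4–§3.5] -/
theorem Loc.selfSimilar_ae_eq_zero_of_absRadialPressureDeficitC2_profile {ρ : ℝ} (hρ : 0 < ρ) (hρ1 : ρ ≤ 1 / 2)
    {u : ℝ → EuclideanSpace ℝ (Fin 3) → EuclideanSpace ℝ (Fin 3)} {p : ℝ → EuclideanSpace ℝ (Fin 3) → ℝ}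
    {H : ℝ → EuclideanSpace ℝ (Fin 3) → EuclideanSpace ℝ (Fin 3) →L[ℝ] EuclideanSpace ℝ (Fin 3)} {c : ℝ≥0}
    (hsw : IsSuitableWeakSolutionOn (slab (EuclideanSpace ℝ (Fin 3)) (Iio 0) isOpen_Iio) 0 0 u p)
    (hH : HasWeakSpatialGradientOn (slab (EuclideanSpace ℝ (Fin 3)) (Iio 0) isOpen_Iio) u H)
    (hgauge : ∀ a : ℝ, 0 < a →
      ENNReal.ofReal (a ^ (2 * ρ)) * cknA a (0 : ℝ × EuclideanSpace ℝ (Fin 3)) u +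
          ENNReal.ofReal (a ^ ρ) * cknE a (0 : ℝ × EuclideanSpace ℝ (Fin 3)) H +
        ENNReal.ofReal (a ^ (2 * ρ)) * cknD a (0 : ℝ × EuclideanSpace ℝ (Fin 3)) p ≤ (c : ℝ≥0∞))
    {V : EuclideanSpace ℝ (Fin 3) → EuclideanSpace ℝ (Fin 3)} {P : EuclideanSpace ℝ (Fin 3) → ℝ}
    (hu : ∀ τ : ℝ, τ < 0 → u τ = selfSimilarCollapse (1 / (2 + ρ)) 0 V τ)
    (hp : ∀ τ : ℝ, τ < 0 → p τ = selfSimilarCollapsePressure (1 / (2 + ρ)) 0 P τ)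
    (hV : ContDiff ℝ 2 V) {κb a₀ : ℝ} (hκb : 0 < κb) (ha₀ : 0 < a₀)
    (hRad : ∀ P' : EuclideanSpace ℝ (Fin 3) → ℝ, IsSelfSimilarEulerProfile (1 / (2 + ρ)) 0 V P' →
      ∀ h : ℝ, ∃ R₀ : ℝ, ∀ y : EuclideanSpace ℝ (Fin 3), R₀ ≤ ‖y‖ →
        h < selfSimilarBernoulli (1 / (2 + ρ)) 0 V P' y → curl V y ≠ 0 →
          -κb ≤ ⟪y, selfSimilarTransport (1 / (2 + ρ)) 0 V y⟫ →
          ⟪y, selfSimilarTransport (1 / (2 + ρ)) 0 V y⟫ ≤ 0 →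
          ⟪y, gradient P' y⟫ ≤ ‖selfSimilarTransport (1 / (2 + ρ)) 0 V y‖ ^ 2 +
            (1 / (2 + ρ)) * (1 - 1 / (2 + ρ)) * ‖y‖ ^ 2 - a₀) :
    uncurry u =ᵐ[volume.restrict (Iio (0 : ℝ) ×ˢ (univ : Set (EuclideanSpace ℝ (Fin 3))))] 0 := by
  have hγ : 1 / (2 + ρ) ≤ 1 / 2 := one_div_le_one_div_of_le (by norm_num) (by linarith)
  refine Loc.selfSimilar_ae_eq_zero_of_absBandDeficitC2_profile hρ hρ1 hsw hH hgauge hu hp hV hκb ha₀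
    fun P' hprof h => ?_
  obtain ⟨R₀, hR₀⟩ := hRad P' hprof h
  exact ⟨R₀, fun y hy hh hcurl hlo hhi =>
    RadialPressureForm.absDeficit_of_radialPressureDeficit hprof hγ hhi (hR₀ y hy hh hcurl hlo hhi)⟩

namespace Past

variable {ρ T T₁ : ℝ}
  {u : ℝ → EuclideanSpace ℝ (Fin 3) → EuclideanSpace ℝ (Fin 3)} {p : ℝ → EuclideanSpace ℝ (Fin 3) → ℝ}
  {H : ℝ → EuclideanSpace ℝ (Fin 3) → EuclideanSpace ℝ (Fin 3) →L[ℝ] EuclideanSpace ℝ (Fin 3)} {c : ℝ≥0}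
  {V : EuclideanSpace ℝ (Fin 3) → EuclideanSpace ℝ (Fin 3)} {P : EuclideanSpace ℝ (Fin 3) → ℝ}

/-- **PAST-EXACT MEMBER WHOSE `C²` PROFILE HAS AN ABSOLUTE RADIAL-PRESSURE DEFICIT ON THE FAR VORTICAL BERNOULLI-HIGH ABSOLUTE INFLOW BAND IS
TRIVIAL** (crux hypotheses verbatim, `0 < ρ ≤ ½`; exact self-similarity about `(T, x₀)` for `τ < T₁`, `T₁ ≤ 0`, `T₁ ≤ T`; `V ∈ C²`; the
hypothesis of `Loc.selfSimilar_ae_eq_zero_of_absRadialPressureDeficitC2_profile`).  By-name corollary of the LEAD's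
`Past.selfSimilar_ae_eq_zero_of_absBandDeficitC2_profile_past`. [folklore; cf. ConstantinIgnatovaVicol2026Putative §3.4–§3.5] -/
theorem selfSimilar_ae_eq_zero_of_absRadialPressureDeficitC2_profile_past (hρ : 0 < ρ) (hρh : ρ ≤ 1 / 2) (hT₁ : T₁ ≤ 0)
    (hTT₁ : T₁ ≤ T) (x₀ : EuclideanSpace ℝ (Fin 3))
    (hsw : IsSuitableWeakSolutionOn (slab (EuclideanSpace ℝ (Fin 3)) (Iio 0) isOpen_Iio) 0 0 u p)
    (hH : HasWeakSpatialGradientOn (slab (EuclideanSpace ℝ (Fin 3)) (Iio 0) isOpen_Iio) u H)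
    (hgauge : ∀ a : ℝ, 0 < a →
      ENNReal.ofReal (a ^ (2 * ρ)) * cknA a (0 : ℝ × EuclideanSpace ℝ (Fin 3)) u +
          ENNReal.ofReal (a ^ ρ) * cknE a (0 : ℝ × EuclideanSpace ℝ (Fin 3)) H +
        ENNReal.ofReal (a ^ (2 * ρ)) * cknD a (0 : ℝ × EuclideanSpace ℝ (Fin 3)) p ≤ (c : ℝ≥0∞))
    (hu : ∀ τ : ℝ, τ < T₁ → u τ = fun x => selfSimilarCollapse (1 / (2 + ρ)) T V τ (x - x₀))
    (hp : ∀ τ : ℝ, τ < T₁ → p τ = fun x => selfSimilarCollapsePressure (1 / (2 + ρ)) T P τ (x - x₀))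
    (hV : ContDiff ℝ 2 V) {κb a₀ : ℝ} (hκb : 0 < κb) (ha₀ : 0 < a₀)
    (hRad : ∀ P' : EuclideanSpace ℝ (Fin 3) → ℝ, IsSelfSimilarEulerProfile (1 / (2 + ρ)) 0 V P' →
      ∀ h : ℝ, ∃ R₀ : ℝ, ∀ y : EuclideanSpace ℝ (Fin 3), R₀ ≤ ‖y‖ →
        h < selfSimilarBernoulli (1 / (2 + ρ)) 0 V P' y → curl V y ≠ 0 →
          -κb ≤ ⟪y, selfSimilarTransport (1 / (2 + ρ)) 0 V y⟫ →
          ⟪y, selfSimilarTransport (1 / (2 + ρ)) 0 V y⟫ ≤ 0 →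
          ⟪y, gradient P' y⟫ ≤ ‖selfSimilarTransport (1 / (2 + ρ)) 0 V y‖ ^ 2 +
            (1 / (2 + ρ)) * (1 - 1 / (2 + ρ)) * ‖y‖ ^ 2 - a₀) :
    uncurry u =ᵐ[volume.restrict (Iio (0 : ℝ) ×ˢ (univ : Set (EuclideanSpace ℝ (Fin 3))))] 0 := by
  have hγ : 1 / (2 + ρ) ≤ 1 / 2 := one_div_le_one_div_of_le (by norm_num) (by linarith)
  refine selfSimilar_ae_eq_zero_of_absBandDeficitC2_profile_past hρ hρh hT₁ hTT₁ x₀ hsw hH hgauge hu hp hV hκb ha₀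
    fun P' hprof h => ?_
  obtain ⟨R₀, hR₀⟩ := hRad P' hprof h
  exact ⟨R₀, fun y hy hh hcurl hlo hhi =>
    RadialPressureForm.absDeficit_of_radialPressureDeficit hprof hγ hhi (hR₀ y hy hh hcurl hlo hhi)⟩

end Past

end Summit.NavierStokesRegularity.NavierStokesRegularity.Theorems.PowerGaugeEulerLiouville

end
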